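import Mathlib
import Summits.ValiantsHypothesis.ValiantsHypothesis.Theorems.BarrierLeverPartitionMinorsHitByVPHiddenStatesStack
import Summits.ValiantsHypothesis.ValiantsHypothesis.Theorems.BarrierLeverPartitionMinorsHitByVPHiddenStatesCoreFree
import Summits.ValiantsHypothesis.ValiantsHypothesis.Theorems.BarrierLeverPartitionMinorsHitByVPHiddenStatesFreeParts

/-!
# Route BarrierLever — item `PartitionMinorsHitByVP` (stmt-ValiantsHypothesis-19717), line `hidden-states`:
# THE CO-STAR RECURSION, part 1/3 — leaves (sub-cube tilings, free columns), the facet-counting fact, and the predicate form of nested stacking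

Helper file (`--supports stmt-ValiantsHypothesis-19717`; cell valiant-natproofs, rung V4, 𝒟-side door (c), registered line
`Cruxes/PartitionMinorsHitByVP/Lines/hidden_states.lean` v7; prover seat val-np-p6 gen 11). Definition-free; closes NO item.

THE POINT. The co-star piece `T_{h,c}` (all state sets except the top and `c` co-singletons; memo val-np-p6 g10 §9–§10, p614189–p617953)
is conjectured to serve every injective row family of its size; for LOWER row families the missing rows form an up-set `𝒜` of size `c+1`
and two FACET STACKS (`SymbJoin.symGood_of_stack`, p610391) reduce the instance one dimension down: (R1) a coordinate lying in every
missing row + a NON-special marker state (zero child = full-cube tiling), (R2′) a coordinate avoided by exactly one missing row + a SPECIAL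
marker state (zero child = cube-minus-top tiling). This file supplies the generic ingredients of that recursion, for SUB-CUBE instances
(coordinates in a block `Y ⊆ Fin n`, states in a block `Q ⊆ Fin K`, one piece `p₀` among `m`), in the symbolic language `SymbJoin.symDet ≠ 0`:

* `symGood_of_image_match`, `symGood_subcube_full`, `symGood_subcube_top` — tiling leaves with ARBITRARY injective enumerations: if the
  columns are state sets inside `Q` (resp. proper subsets of `Q`) and every subset (resp. proper subset) of a coordinate block `Y` with
  `|Y| = |Q|` is a row, the configuration is generically good (a bijection `Q → Y` matches columns to rows; `symGood_of_tiling` p601836 +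
  `symGood_of_reindex` p602295).
* `symGood_of_cols_card_le_one` — free leaf: columns of size `≤ 1` (the saturated co-star `T_{3,3} = B₁([3])`, and smaller) serve every
  injective row family (`symGood_of_affFree` + `affFree_of_private`, p589275).
* `exists_coord_avoid_le_one` — THE FACET-COUNTING FACT: an up-closed family `𝒜` of subsets of `Y` with `|𝒜| ≤ |Y| + 1` has a coordinate
  `x ∈ Y` avoided by at most one member (else `𝒜 ⊇ {Y} ∪ {Y ∖ x}` already exhausts the budget and no second avoider exists).
* `symGood_of_stack_pred` — nested stacking with the four enumerations built internally from the predicates «`x ∈ row`», «`q ∈ column`»: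
  the user proves the two children good for EVERY injective enumeration of the prescribed index sets (the form in which an induction
  hypothesis quantified over enumerations applies verbatim).

Parts 2/3 and 3/3 (`…CoStarRecursion`, `…CoStarLowerCells`) run the induction (all `c ≤ 4`) and read off the all-`h` LOWER cells
`r = 2^h − 4, 2^h − 5` of `LowerNode.Stmt.universalJoinWideLower`. WHAT THIS IS NOT: no stub of the line is closed; nothing on crux 14610 or VP ≠ VNP.
-/

set_option linter.dupNamespace false

namespace Summit.ValiantsHypothesis.ValiantsHypothesis.Theorems.BarrierLever.HiddenStates

open Finset Matrix MvPolynomial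

noncomputable section

namespace SymbJoin

variable {n m K r : ℕ}

/-! ## 1. Tiling leaves for sub-cube instances -/

/-- Images under a map injective on `Q` separate the subsets of `Q`. -/
theorem image_injOn_subsets {σ : Fin K → Fin n} {Q J J' : Finset (Fin K)} (hσ : Set.InjOn σ ↑Q)
    (hJ : J ⊆ Q) (hJ' : J' ⊆ Q) (h : J.image σ = J'.image σ) : J = J' := by
  classical
  ext q
  constructor
  · intro hq
    have : σ q ∈ J'.image σ := h ▸ Finset.mem_image_of_mem σ hq
    obtain ⟨q', hq', hqq⟩ := Finset.mem_image.mp this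
    rw [hσ (hJ hq) (hJ' hq') hqq.symm]; exact hq'
  · intro hq
    have : σ q ∈ J.image σ := h.symm ▸ Finset.mem_image_of_mem σ hq
    obtain ⟨q', hq', hqq⟩ := Finset.mem_image.mp this
    rw [hσ (hJ' hq) (hJ hq') hqq.symm]; exact hq'

/-- **Matched tiling with free enumerations.** One piece; the columns are state sets inside `Q`, `σ` is injective on `Q`, and every
`σ`-image of a column is SOME row. Then the configuration is generically good. -/
theorem symGood_of_image_match (p₀ : Fin m) (u : Fin r → Finset (Fin n)) (hu : Function.Injective u)
    (cols : Fin r → Finset (Fin K)) (hcols : Function.Injective cols) (Q : Finset (Fin K)) (σ : Fin K → Fin n)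
    (hσ : Set.InjOn σ ↑Q) (hcQ : ∀ k, cols k ⊆ Q) (hmatch : ∀ k, ∃ i, u i = (cols k).image σ) :
    symDet u (fun k => (p₀, cols k)) ≠ 0 := by
  classical
  choose π hπ using hmatch
  have hπinj : Function.Injective π := by
    intro k k' hkk
    apply hcols
    apply image_injOn_subsets hσ (hcQ k) (hcQ k')
    rw [← hπ k, ← hπ k', hkk]
  have hbij : Function.Bijective π := (Fintype.bijective_iff_injective_and_card π).mpr ⟨hπinj, rfl⟩
  refine symGood_of_reindex u (fun k => (p₀, cols k)) (Equiv.ofBijective π hbij) (Equiv.refl _) ?_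
  refine symGood_of_tiling (fun i => u (Equiv.ofBijective π hbij i)) (hu.comp hπinj) (fun k => (p₀, cols k))
    (fun _ => ∅) (fun _ q => σ q) fun k a => ?_
  simp only [Equiv.ofBijective_apply, hπ k, Finset.mem_image, Finset.notMem_empty, false_or]

/-- A bijection between two equinumerous blocks, as a function on all states (junk value off `Q`). -/
theorem exists_injOn_image_eq (Q : Finset (Fin K)) (Y : Finset (Fin n)) (hYQ : Y.card = Q.card) (hY : Y.Nonempty) :
    ∃ σ : Fin K → Fin n, Set.InjOn σ ↑Q ∧ Q.image σ = Y := by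
  classical
  obtain ⟨y₀, _⟩ := hY
  let e : {q // q ∈ Q} ≃ {y // y ∈ Y} := Q.equivFin.trans ((finCongr hYQ.symm).trans Y.equivFin.symm)
  refine ⟨fun q => if hq : q ∈ Q then (e ⟨q, hq⟩).1 else y₀, ?_, ?_⟩
  · intro q hq q' hq' hqq
    simp only [Finset.mem_coe] at hq hq'
    simp only [hq, hq', dite_true] at hqq
    have := e.injective (Subtype.ext hqq)
    exact congrArg Subtype.val this
  · ext y
    simp only [Finset.mem_image]
    constructor
    · rintro ⟨q, hq, rfl⟩
      simp only [hq, dite_true]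
      exact (e ⟨q, hq⟩).2
    · intro hy
      refine ⟨(e.symm ⟨y, hy⟩).1, (e.symm ⟨y, hy⟩).2, ?_⟩
      simp only [(e.symm ⟨y, hy⟩).2, dite_true, Subtype.coe_eta, Equiv.apply_symm_apply]

/-- **Full-cube leaf.** Columns inside a state block `Q`, and every subset of a coordinate block `Y` with `|Y| = |Q|` is a row:
generically good (any injective enumerations). -/
theorem symGood_subcube_full (p₀ : Fin m) (u : Fin r → Finset (Fin n)) (hu : Function.Injective u)
    (cols : Fin r → Finset (Fin K)) (hcols : Function.Injective cols) (Y : Finset (Fin n)) (Q : Finset (Fin K))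
    (hYQ : Y.card = Q.card) (hcQ : ∀ k, cols k ⊆ Q) (hrow : ∀ S, S ⊆ Y → ∃ i, u i = S) :
    symDet u (fun k => (p₀, cols k)) ≠ 0 := by
  classical
  by_cases hY : Y.Nonempty
  · obtain ⟨σ, hσ, hσY⟩ := exists_injOn_image_eq Q Y hYQ hY
    refine symGood_of_image_match p₀ u hu cols hcols Q σ hσ hcQ fun k => hrow _ ?_
    rw [← hσY]; exact Finset.image_subset_image (hcQ k)
  · -- `Y = ∅ = Q`: all columns are `∅`, so there is at most one column: lonely
    rw [Finset.not_nonempty_iff_eq_empty] at hY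
    have hQ : Q = ∅ := by rw [← Finset.card_eq_zero, ← hYQ, hY, Finset.card_empty]
    refine symGood_of_lonely u hu _ fun k k' _ => hcols ?_
    have h1 := hcQ k; have h2 := hcQ k'
    rw [hQ, Finset.subset_empty] at h1 h2
    rw [h1, h2]

/-- **Cube-minus-top leaf.** Columns are PROPER subsets of `Q`, and every proper subset of `Y` (`|Y| = |Q|`) is a row: generically good. -/
theorem symGood_subcube_top (p₀ : Fin m) (u : Fin r → Finset (Fin n)) (hu : Function.Injective u)
    (cols : Fin r → Finset (Fin K)) (hcols : Function.Injective cols) (Y : Finset (Fin n)) (Q : Finset (Fin K))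
    (hYQ : Y.card = Q.card) (hcQ : ∀ k, cols k ⊆ Q ∧ cols k ≠ Q) (hrow : ∀ S, S ⊆ Y → S ≠ Y → ∃ i, u i = S) :
    symDet u (fun k => (p₀, cols k)) ≠ 0 := by
  classical
  by_cases hY : Y.Nonempty
  · obtain ⟨σ, hσ, hσY⟩ := exists_injOn_image_eq Q Y hYQ hY
    refine symGood_of_image_match p₀ u hu cols hcols Q σ hσ (fun k => (hcQ k).1) fun k => hrow _ ?_ ?_
    · rw [← hσY]; exact Finset.image_subset_image (hcQ k).1
    · intro hEq
      apply (hcQ k).2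
      apply Finset.eq_of_subset_of_card_le (hcQ k).1
      have := congrArg Finset.card hEq
      rw [Finset.card_image_of_injOn (fun a ha b hb hab => hσ ((hcQ k).1 ha) ((hcQ k).1 hb) hab), hYQ] at this
      omega
  · rw [Finset.not_nonempty_iff_eq_empty] at hY
    have hQ : Q = ∅ := by rw [← Finset.card_eq_zero, ← hYQ, hY, Finset.card_empty]
    refine symGood_of_lonely u hu _ fun k => ?_
    exfalso
    have h1 := hcQ k
    rw [hQ, Finset.subset_empty] at h1
    exact h1.2 h1.1

/-! ## 2. The free leaf: columns of size at most one -/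

/-- **Free leaf.** One piece whose columns are injective state sets of size `≤ 1` (the empty set and singletons — e.g. the saturated
co-star `T_{3,3}`): generically good for EVERY injective row family. -/
theorem symGood_of_cols_card_le_one (p₀ : Fin m) (u : Fin r → Finset (Fin n)) (hu : Function.Injective u)
    (cols : Fin r → Finset (Fin K)) (hcols : Function.Injective cols) (hsmall : ∀ k, (cols k).card ≤ 1) :
    symDet u (fun k => (p₀, cols k)) ≠ 0 := by
  classical
  rcases Nat.eq_zero_or_pos K with hK | hK
  · -- no states: every column is `∅`, at most one column
    subst hK
    refine symGood_of_lonely u hu _ fun k k' _ => hcols ?_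
    rw [Finset.eq_empty_of_isEmpty (cols k), Finset.eq_empty_of_isEmpty (cols k')]
  rcases Nat.eq_zero_or_pos r with hr | hr
  · subst hr
    show (symMat u fun k => (p₀, cols k)).det ≠ 0
    rw [Matrix.det_isEmpty]; exact one_ne_zero
  -- the possibly-empty column and the private states
  let k₀ : Fin r := if hk : ∃ k, cols k = ∅ then hk.choose else ⟨0, hr⟩
  let pv : Fin r → Fin K := fun k => if hk : (cols k).Nonempty then hk.choose else ⟨0, hK⟩
  have hne : ∀ k, k ≠ k₀ → (cols k).Nonempty := by
    intro k hk
    rw [Finset.nonempty_iff_ne_empty]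
    intro hke
    apply hk
    have hex : ∃ k, cols k = ∅ := ⟨k, hke⟩
    have hk₀ : cols k₀ = ∅ := by
      simp only [k₀, hex, dite_true]; exact hex.choose_spec
    exact hcols (hke.trans hk₀.symm)
  have hpv : ∀ k, k ≠ k₀ → cols k = {pv k} := by
    intro k hk
    have hn := hne k hk
    have hmem : pv k ∈ cols k := by simp only [pv, hn, dite_true]; exact hn.choose_spec
    exact Finset.eq_singleton_iff_unique_mem.mpr ⟨hmem, fun q hq => Finset.card_le_one.mp (hsmall k) q hq _ hmem⟩
  refine symGood_of_affFree u hu _ fun p => ?_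
  by_cases hp : p = p₀
  · subst hp
    refine affFree_of_private _ p k₀ pv (fun k _ hk => ?_) (fun k k' _ _ hk hk' hmem => ?_)
    · show pv k ∈ cols k
      rw [hpv k hk]; exact Finset.mem_singleton_self _
    · change pv k ∈ cols k' at hmem
      apply hk'
      apply hcols
      rw [hpv k hk]
      exact Finset.eq_singleton_iff_unique_mem.mpr
        ⟨hmem, fun q hq => Finset.card_le_one.mp (hsmall k') q hq _ hmem⟩
  · haveI : IsEmpty {k : Fin r // ((fun k => (p₀, cols k)) k).1 = p} := ⟨fun k => hp k.2.symm⟩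
    exact linearIndependent_empty_type

/-! ## 3. The facet-counting fact -/

/-- **Some coordinate is avoided by at most one member.** If `𝒜` is a nonempty up-closed family of subsets of a nonempty block `Y`
with `|𝒜| ≤ |Y| + 1`, then some `x ∈ Y` lies outside at most one member of `𝒜`. -/
theorem exists_coord_avoid_le_one (Y : Finset (Fin n)) (𝒜 : Finset (Finset (Fin n))) (h𝒜Y : ∀ A ∈ 𝒜, A ⊆ Y)
    (hup : ∀ A ∈ 𝒜, ∀ A', A ⊆ A' → A' ⊆ Y → A' ∈ 𝒜) (hne : 𝒜.Nonempty) (hcard : 𝒜.card ≤ Y.card + 1)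
    (hY : Y.Nonempty) : ∃ x ∈ Y, (𝒜.filter fun A => x ∉ A).card ≤ 1 := by
  classical
  by_contra hno
  push Not at hno
  have hY𝒜 : Y ∈ 𝒜 := by
    obtain ⟨A, hA⟩ := hne
    exact hup A hA Y (h𝒜Y A hA) subset_rfl
  have herase : ∀ x ∈ Y, Y.erase x ∈ 𝒜 := by
    intro x hx
    obtain ⟨A, hA⟩ : (𝒜.filter fun A => x ∉ A).Nonempty := Finset.card_pos.mp (by have := hno x hx; omega)
    rw [Finset.mem_filter] at hA
    exact hup A hA.1 _ (fun y hy => Finset.mem_erase.mpr ⟨fun h => hA.2 (h ▸ hy), h𝒜Y A hA.1 hy⟩)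
      (Finset.erase_subset _ _)
  set F : Finset (Finset (Fin n)) := insert Y (Y.image fun x => Y.erase x) with hF
  have hFsub : F ⊆ 𝒜 := by
    intro A hA
    rw [hF, Finset.mem_insert] at hA
    rcases hA with rfl | hA
    · exact hY𝒜
    · obtain ⟨x, hx, rfl⟩ := Finset.mem_image.mp hA
      exact herase x hx
  have hnot : Y ∉ Y.image fun x => Y.erase x := by
    intro hmem
    obtain ⟨x, hx, hxe⟩ := Finset.mem_image.mp hmem
    have : x ∉ Y.erase x := Finset.notMem_erase x Y
    rw [hxe] at this
    exact this hx
  have hFcard : F.card = Y.card + 1 := by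
    rw [hF, Finset.card_insert_of_notMem hnot, Finset.card_image_of_injOn (Finset.erase_injOn Y)]
  have hF𝒜 : F = 𝒜 := Finset.eq_of_subset_of_card_le hFsub (by omega)
  obtain ⟨x, hx⟩ := hY
  have hsub : (𝒜.filter fun A => x ∉ A) ⊆ {Y.erase x} := by
    intro A hA
    rw [Finset.mem_filter, ← hF𝒜, hF, Finset.mem_insert] at hA
    obtain ⟨hA, hxA⟩ := hA
    rw [Finset.mem_singleton]
    rcases hA with rfl | hA
    · exact absurd hx hxA
    · obtain ⟨x', hx', rfl⟩ := Finset.mem_image.mp hA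
      have : x = x' := by
        by_contra hxx
        exact hxA (Finset.mem_erase.mpr ⟨hxx, hx⟩)
      rw [this]
  have := Finset.card_le_card hsub
  rw [Finset.card_singleton] at this
  have := hno x hx
  omega

/-! ## 4. Nested stacking, predicate form -/

/-- **Nested stacking with internal enumerations (one piece).** Fix a coordinate `x` and a marker state `q`; suppose as many rows avoid
`x` as columns avoid `q`. If the zero child (rows avoiding `x`, columns avoiding `q`) and the link child (rows through `x` with `x`
erased, columns through `q` with `q` erased) are generically good FOR EVERY pair of injective enumerations of these index sets, then the
configuration is generically good (`symGood_of_stack`, p610391). -/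
theorem symGood_of_stack_pred (p₀ : Fin m) (u : Fin r → Finset (Fin n)) (cols : Fin r → Finset (Fin K)) (x : Fin n) (q : Fin K)
    (hcard : (Finset.univ.filter fun i => x ∉ u i).card = (Finset.univ.filter fun k => q ∉ cols k).card)
    (h0 : ∀ (r₀ : ℕ) (f g : Fin r₀ → Fin r), Function.Injective f → Function.Injective g →
      (∀ j, x ∉ u (f j)) → (∀ i, x ∉ u i → ∃ j, f j = i) → (∀ j, q ∉ cols (g j)) → (∀ k, q ∉ cols k → ∃ j, g j = k) →
      symDet (fun j => u (f j)) (fun j => (p₀, cols (g j))) ≠ 0)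
    (h1 : ∀ (r₁ : ℕ) (f g : Fin r₁ → Fin r), Function.Injective f → Function.Injective g →
      (∀ j, x ∈ u (f j)) → (∀ i, x ∈ u i → ∃ j, f j = i) → (∀ j, q ∈ cols (g j)) → (∀ k, q ∈ cols k → ∃ j, g j = k) →
      symDet (fun j => (u (f j)).erase x) (fun j => (p₀, (cols (g j)).erase q)) ≠ 0) :
    symDet u (fun k => (p₀, cols k)) ≠ 0 := by
  classical
  set I₀ := Finset.univ.filter fun i => x ∉ u i with hI₀
  set I₁ := Finset.univ.filter fun i => x ∈ u i with hI₁
  set K₀ := Finset.univ.filter fun k => q ∉ cols k with hK₀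
  set K₁ := Finset.univ.filter fun k => q ∈ cols k with hK₁
  have hI : I₁.card + I₀.card = r := by
    rw [hI₁, hI₀, Finset.card_filter_add_card_filter_not, Finset.card_univ, Fintype.card_fin]
  have hKc : K₁.card + K₀.card = r := by
    rw [hK₁, hK₀, Finset.card_filter_add_card_filter_not, Finset.card_univ, Fintype.card_fin]
  have hK0 : K₀.card = I₀.card := hcard.symm
  have hK1 : K₁.card = I₁.card := by omega
  let f₀ : Fin I₀.card → Fin r := fun j => (I₀.equivFin.symm j).1
  let f₁ : Fin I₁.card → Fin r := fun j => (I₁.equivFin.symm j).1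
  let g₀ : Fin I₀.card → Fin r := fun j => (K₀.equivFin.symm (Fin.cast hK0.symm j)).1
  let g₁ : Fin I₁.card → Fin r := fun j => (K₁.equivFin.symm (Fin.cast hK1.symm j)).1
  have hf₀m : ∀ j, x ∉ u (f₀ j) := fun j => (Finset.mem_filter.mp (I₀.equivFin.symm j).2).2
  have hf₁m : ∀ j, x ∈ u (f₁ j) := fun j => (Finset.mem_filter.mp (I₁.equivFin.symm j).2).2
  have hg₀m : ∀ j, q ∉ cols (g₀ j) := fun j => (Finset.mem_filter.mp (K₀.equivFin.symm (Fin.cast hK0.symm j)).2).2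
  have hg₁m : ∀ j, q ∈ cols (g₁ j) := fun j => (Finset.mem_filter.mp (K₁.equivFin.symm (Fin.cast hK1.symm j)).2).2
  have hf₀i : Function.Injective f₀ := fun j j' h => I₀.equivFin.symm.injective (Subtype.ext h)
  have hf₁i : Function.Injective f₁ := fun j j' h => I₁.equivFin.symm.injective (Subtype.ext h)
  have hg₀i : Function.Injective g₀ := fun j j' h =>
    Fin.cast_injective _ (K₀.equivFin.symm.injective (Subtype.ext h))
  have hg₁i : Function.Injective g₁ := fun j j' h =>
    Fin.cast_injective _ (K₁.equivFin.symm.injective (Subtype.ext h))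
  have hf₀s : ∀ i, x ∉ u i → ∃ j, f₀ j = i := fun i hi => by
    have hmem : i ∈ I₀ := Finset.mem_filter.mpr ⟨Finset.mem_univ _, hi⟩
    exact ⟨I₀.equivFin ⟨i, hmem⟩, by simp [f₀]⟩
  have hf₁s : ∀ i, x ∈ u i → ∃ j, f₁ j = i := fun i hi => by
    have hmem : i ∈ I₁ := Finset.mem_filter.mpr ⟨Finset.mem_univ _, hi⟩
    exact ⟨I₁.equivFin ⟨i, hmem⟩, by simp [f₁]⟩
  have hg₀s : ∀ k, q ∉ cols k → ∃ j, g₀ j = k := fun k hk => by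
    have hmem : k ∈ K₀ := Finset.mem_filter.mpr ⟨Finset.mem_univ _, hk⟩
    exact ⟨Fin.cast hK0 (K₀.equivFin ⟨k, hmem⟩), by simp [g₀]⟩
  have hg₁s : ∀ k, q ∈ cols k → ∃ j, g₁ j = k := fun k hk => by
    have hmem : k ∈ K₁ := Finset.mem_filter.mpr ⟨Finset.mem_univ _, hk⟩
    exact ⟨Fin.cast hK1 (K₁.equivFin ⟨k, hmem⟩), by simp [g₁]⟩
  have hf : Function.Injective (Sum.elim f₀ f₁) :=
    hf₀i.sumElim hf₁i fun a b hab => hf₀m a (hab ▸ hf₁m b)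
  have hg : Function.Injective (Sum.elim g₀ g₁) :=
    hg₀i.sumElim hg₁i fun a b hab => hg₀m a (hab ▸ hg₁m b)
  exact symGood_of_stack u (fun k => (p₀, cols k)) x (fun _ => q) (by omega) f₀ f₁ g₀ g₁ hf hg hf₀m hf₁m hg₀m hg₁m
    (h0 _ f₀ g₀ hf₀i hg₀i hf₀m hf₀s hg₀m hg₀s) (h1 _ f₁ g₁ hf₁i hg₁i hf₁m hf₁s hg₁m hg₁s)

end SymbJoin

end

end Summit.ValiantsHypothesis.ValiantsHypothesis.Theorems.BarrierLever.HiddenStates
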